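import Literature.Computability.Complexity.EquivalenceProblems
import Literature.Computability.Complexity.PRelHierarchy
import Literature.Computability.Complexity.BranchingFn
import HarnessLib

/-!
# `CF = Ker ⟹ PH = ZPP^NP` (Fortnow–Grochow 2011, Cor. 3.4), part I: canonical witnesses and the selector tournament

First file of the proof of the named fact `Literature.Computability.Complexity.blassGurevich_CF_eq_Ker_PH`
(`EquivalenceProblems.lean`; Fortnow–Grochow 2011 = arXiv:0907.4775, Cor. 3.4: "If `CF = Ker` then
`PH = ZPP^NP`", obtained there from Blass–Gurevich II Thm. 3 (`Ker(FP)_= ⊆ CF(NPSV_t) ⟹ NPMV ⊆_c NPSV`),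
Hemaspaandra–Naik–Ogihara–Selman 1996 (`NPMV ⊆_c NPSV ⟹ SAT ∈ (NP ∩ coNP)/poly`, by a tournament
argument) and Köbler–Watanabe 1998 (`NP ⊆ (NP ∩ coNP)/poly ⟹ PH = ZPP^NP`)). This part formalises the
first two ingredients at the level of predicates on strings; no machine is built here beyond `FP`/`P`
closure properties.

* **A. Canonical witnesses** (the proof of FG Thm. 4.1, which is the core of BG II Thm. 3): under
  `KerFP ⊆ CFFP`, for every `R ∈ P` (read as a verifier relation on pairs `⟨i, w⟩`) there is `cw ∈ FP`
  with `⟨i, w⟩ ∈ R → ⟨i, cw ⟨i, w⟩⟩ ∈ R` and `cw ⟨i, w⟩ = cw ⟨i, w'⟩` for any two witnesses `w, w'` of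
  `i` (`CFKer.exists_isCanonWitFn`): apply the hypothesis to the kernel of
  `z ↦ ⟨fst z, [⟨fst z, snd z⟩ ∈ R]⟩` (`CFKer.kerFn`), literally FG's `(x, y) ↦ (x, V(x, y))`.
* **B. The selector and its tournament** (HNOS 1996, proof of Thm. 1 / FG §3: a single-valued
  refinement of the two-valued function "a member among `a`, `b`"): for a verifier `Rp` the *pair
  verifier* `CFKer.R₂ Rp` accepts `⟨⟨a, b⟩, ⟨t, w⟩⟩` iff `t = 0 ∧ ⟨a, w⟩ ∈ Rp` or `t = 1 ∧ ⟨b, w⟩ ∈ Rp`;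
  a canonical-witness function `cw` for `R₂ Rp` selects, for every pair with at least one member, a
  canonical side `fst (cw …) ∈ {0, 1}`. "`b` (with witness `wb`) beats `a`" (`CFKer.beats`) asks that
  the canonical side be `b` for both orders `⟨a, b⟩`, `⟨b, a⟩`; it is decidable in `P` from `b, wb, a`
  (`CFKer.BeatsL_mem_P`), *forced* when `a` has no witness (`beats_of_not_hasWit`) and *antisymmetric*
  on members (`not_beats_symm`) — the tournament of HNOS.
* **Advice and the bad set** (HNOS 1996, proof of Thm. 1: the advice is a small set of members beaten
  by nobody outside): an advice is a list `K` of entry strings `e = ⟨k, wk⟩`; `CFKer.Cert K a` — every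
  valid entry of `K` has key `≠ a` and beats `a` — is the `NP`-certifiable non-membership test, and
  `CFKer.Bad K a` (a member passing `Cert`) is what a good advice excludes; `not_hasWit_iff_cert`:
  if no element of `U` is bad then on `U` non-membership is exactly `Cert`; `bad_mono`, `bad_of_bad_cons`
  (adding entries only shrinks the bad set, and after adding a valid entry `e` the bad set lies in the
  out-neighbourhood of `e`) feed the halving analysis of part II.

## References

* L. Fortnow, J. A. Grochow, *Complexity classes of equivalence problems revisited*, Inform. and
  Comput. 209 (2011) 748–763 = arXiv:0907.4775, Thm. 4.1 (proof), §3 (Thm. 3.3, Cor. 3.4).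
* A. Blass, Y. Gurevich, *Equivalence relations, invariants, and normal forms II*, LNCS 171 (1984)
  24–42, Thm. 3.
* L. A. Hemaspaandra, A. V. Naik, M. Ogihara, A. L. Selman, *Computing solutions uniquely collapses
  the polynomial hierarchy*, SIAM J. Comput. 25 (1996) 697–708, Thm. 1 and its proof.
-/

namespace Literature.Computability.Complexity

open _root_.Computability

namespace CFKer

/-! ### Pairs -/

/-- Components of equal pairs are equal. [Arora–Barak 2009, §0.1] [folklore] -/
private theorem boolPair_inj {a b a' b' : List Bool} (h : boolPair a b = boolPair a' b') : a = a' ∧ b = b' := by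
  have h1 : fstP (boolPair a b) = fstP (boolPair a' b') := by rw [h]
  have h2 : sndP (boolPair a b) = sndP (boolPair a' b') := by rw [h]
  rw [fstP_boolPair, fstP_boolPair] at h1
  rw [sndP_boolPair, sndP_boolPair] at h2
  exact ⟨h1, h2⟩

/-! ### A. Canonical witnesses from `KerFP ⊆ CFFP` (FG Thm. 4.1, proof) -/

/-- The polynomial-time map of the proof of FG Thm. 4.1, `(x, y) ↦ (x, V(x, y))`: on any string `z`,
`z ↦ ⟨fst z, [⟨fst z, snd z⟩ ∈ R]⟩` (total projections). Its kernel identifies two witnesses, or two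
non-witnesses, of the same instance. [cite: FortnowGrochow2011, Thm. 4.1 (proof)] -/
noncomputable def kerFn (R : Language Bool) : List Bool → List Bool :=
  pairFn fstP ((fun y => encodeBool (R.boolIndicator y)) ∘ pairFn fstP sndP)

/-- `kerFn R ∈ FP` for `R ∈ P`. [cite: FortnowGrochow2011, Thm. 4.1 (proof)] -/
theorem kerFn_mem_FP {R : Language Bool} (hR : R ∈ Classes.P) : kerFn R ∈ FP :=
  pairFn_mem_FP fstP_mem_FP
    (comp_mem_FP (indicatorFn_mem_FP hR) (pairFn_mem_FP fstP_mem_FP sndP_mem_FP))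

/-- Value of `kerFn`. [folklore] -/
theorem kerFn_apply (R : Language Bool) (z : List Bool) :
    kerFn R z = boolPair (fstP z) [R.boolIndicator (boolPair (fstP z) (sndP z))] := by
  rw [kerFn, pairFn_apply, Function.comp_apply, pairFn_apply]
  rfl

/-- Value of `kerFn` on a pair. [folklore] -/
theorem kerFn_boolPair (R : Language Bool) (i w : List Bool) :
    kerFn R (boolPair i w) = boolPair i [R.boolIndicator (boolPair i w)] := by
  rw [kerFn_apply, fstP_boolPair, sndP_boolPair]

/-- `cw` is a *canonical-witness function* for the pair language `R`: it maps a witness of `i` to a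
witness of `i`, the same one for all witnesses of `i`. [cite: FortnowGrochow2011, Thm. 4.1 (proof)] -/
def IsCanonWitFn (R : Language Bool) (cw : List Bool → List Bool) : Prop :=
  (∀ i w, boolPair i w ∈ R → boolPair i (cw (boolPair i w)) ∈ R) ∧
    ∀ i w w', boolPair i w ∈ R → boolPair i w' ∈ R → cw (boolPair i w) = cw (boolPair i w')

/-- **Canonical witnesses** (Fortnow–Grochow 2011, proof of Thm. 4.1; Blass–Gurevich II, Thm. 3):
if `Ker(FP) ⊆ CF(FP)` then every `P` relation has a polynomial-time canonical-witness function — the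
second component of an `FP` canonical form for the kernel of `kerFn R`.
[cite: FortnowGrochow2011, Thm. 4.1 (proof)] -/
theorem exists_isCanonWitFn (h : KerFP ⊆ CFFP) {R : Language Bool} (hR : R ∈ Classes.P) :
    ∃ cw ∈ FP, IsCanonWitFn R cw := by
  have hK : (fun z z' => kerFn R z = kerFn R z') ∈ KerFP :=
    ⟨kerFn R, kerFn_mem_FP hR, fun _ _ => Iff.rfl⟩
  obtain ⟨-, c, hc, hcan⟩ := h hK
  refine ⟨sndP ∘ c, comp_mem_FP sndP_mem_FP hc, ?_, ?_⟩
  · intro i w hw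
    have h1 := hcan.1 (boolPair i w)
    change kerFn R (c (boolPair i w)) = kerFn R (boolPair i w) at h1
    rw [kerFn_apply, kerFn_boolPair, (Set.mem_iff_boolIndicator _ _).1 hw] at h1
    obtain ⟨hfst, hind⟩ := boolPair_inj h1
    rw [hfst] at hind
    have hb : R.boolIndicator (boolPair i (sndP (c (boolPair i w)))) = true := by
      simpa using hind
    exact (Set.mem_iff_boolIndicator _ _).2 hb
  · intro i w w' hw hw'
    have he : kerFn R (boolPair i w) = kerFn R (boolPair i w') := by
      rw [kerFn_boolPair, kerFn_boolPair, (Set.mem_iff_boolIndicator _ _).1 hw,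
        (Set.mem_iff_boolIndicator _ _).1 hw']
    change sndP (c (boolPair i w)) = sndP (c (boolPair i w'))
    rw [hcan.2 _ _ he]

/-! ### Verifiers with the length bound folded in -/

/-- `Rbound R p = {⟨y, w⟩ ∈ R | |w| ≤ p |y|}`: the verifier with its witness-length bound folded in, so
that `y ∈ N ↔ ∃ w, ⟨y, w⟩ ∈ Rbound R p` for the `NP` language `N` it verifies. [Arora–Barak 2009, Def. 2.1] [folklore] -/
noncomputable def Rbound (R : Language Bool) (p : Polynomial ℕ) : Language Bool :=
  LenLe p ⊓ R

/-- `Rbound R p ∈ P`. [folklore] -/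
theorem Rbound_mem_P {R : Language Bool} (hR : R ∈ Classes.P) (p : Polynomial ℕ) :
    Rbound R p ∈ Classes.P :=
  inter_mem_P (LenLe_mem_P p) hR

/-- Membership of a pair in `Rbound`. [folklore] -/
@[simp] theorem boolPair_mem_Rbound (R : Language Bool) (p : Polynomial ℕ) (y w : List Bool) :
    boolPair y w ∈ Rbound R p ↔ w.length ≤ p.eval y.length ∧ boolPair y w ∈ R := by
  change boolPair y w ∈ LenLe p ∧ boolPair y w ∈ R ↔ _
  rw [boolPair_mem_LenLe]

/-- `y` has a witness in the pair language `Rp`. [Arora–Barak 2009, Def. 2.1] [folklore] -/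
def HasWit (Rp : Language Bool) (y : List Bool) : Prop :=
  ∃ w, boolPair y w ∈ Rp

/-- For a verifier presentation of `N`, `HasWit (Rbound R p) = N`. [Arora–Barak 2009, Def. 2.1] [folklore] -/
theorem hasWit_Rbound_iff {N R : Language Bool} {p : Polynomial ℕ}
    (hN : ∀ x, x ∈ N ↔ ∃ y : List Bool, y.length ≤ p.eval x.length ∧ boolPair x y ∈ R) (x : List Bool) :
    HasWit (Rbound R p) x ↔ x ∈ N := by
  rw [hN x]
  simp [HasWit]

/-! ### B. The pair verifier and the selector (HNOS tournament) -/

/-- **The pair verifier** `R₂ Rp`: `⟨⟨a, b⟩, c⟩ ∈ R₂ Rp` iff `fst c = [0] ∧ ⟨a, snd c⟩ ∈ Rp` or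
`fst c = [1] ∧ ⟨b, snd c⟩ ∈ Rp` — a witness for the pair is a tagged witness of one of its sides
(the graph of HNOS's two-valued function `{a, b} ↦` "a member of `{a, b}`").
[HNOS 1996, proof of Thm. 1; FG 2011, Thm. 4.1 (proof)] [cite: FortnowGrochow2011, Thm. 4.1 (proof)] -/
noncomputable def R₂ (Rp : Language Bool) : Language Bool :=
  (pairFn (fstP ∘ fstP) (sndP ∘ sndP) ⁻¹' Rp ⊓ {z | (fstP ∘ sndP) z = (fun _ => [false]) z}) ⊔
    (pairFn (sndP ∘ fstP) (sndP ∘ sndP) ⁻¹' Rp ⊓ {z | (fstP ∘ sndP) z = (fun _ => [true]) z})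

/-- `R₂ Rp ∈ P` for `Rp ∈ P`. [folklore] -/
theorem R₂_mem_P {Rp : Language Bool} (hRp : Rp ∈ Classes.P) : R₂ Rp ∈ Classes.P :=
  union_mem_P
    (inter_mem_P (preimage_mem_P hRp (pairFn_mem_FP (comp_mem_FP fstP_mem_FP fstP_mem_FP)
        (comp_mem_FP sndP_mem_FP sndP_mem_FP)))
      (setOf_apply_eq_apply_mem_P (comp_mem_FP fstP_mem_FP sndP_mem_FP) (const_mem_FP [false])))
    (inter_mem_P (preimage_mem_P hRp (pairFn_mem_FP (comp_mem_FP sndP_mem_FP fstP_mem_FP)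
        (comp_mem_FP sndP_mem_FP sndP_mem_FP)))
      (setOf_apply_eq_apply_mem_P (comp_mem_FP fstP_mem_FP sndP_mem_FP) (const_mem_FP [true])))

/-- Reading `R₂` on `⟨⟨a, b⟩, c⟩`. [folklore] -/
theorem mem_R₂_iff (Rp : Language Bool) (a b c : List Bool) :
    boolPair (boolPair a b) c ∈ R₂ Rp ↔
      (boolPair a (sndP c) ∈ Rp ∧ fstP c = [false]) ∨ (boolPair b (sndP c) ∈ Rp ∧ fstP c = [true]) := by
  change (pairFn (fstP ∘ fstP) (sndP ∘ sndP) (boolPair (boolPair a b) c) ∈ Rp ∧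
      (fstP ∘ sndP) (boolPair (boolPair a b) c) = [false]) ∨
    (pairFn (sndP ∘ fstP) (sndP ∘ sndP) (boolPair (boolPair a b) c) ∈ Rp ∧
      (fstP ∘ sndP) (boolPair (boolPair a b) c) = [true]) ↔ _
  simp only [pairFn_apply, Function.comp_apply, fstP_boolPair, sndP_boolPair]

/-- Reading `R₂` on `⟨⟨a, b⟩, ⟨t, w⟩⟩`. [folklore] -/
theorem mem_R₂_iff' (Rp : Language Bool) (a b t w : List Bool) :
    boolPair (boolPair a b) (boolPair t w) ∈ R₂ Rp ↔
      (boolPair a w ∈ Rp ∧ t = [false]) ∨ (boolPair b w ∈ Rp ∧ t = [true]) := by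
  rw [mem_R₂_iff, fstP_boolPair, sndP_boolPair]

/-- **`b` (with witness `wb`) beats `a`** under the canonical-witness function `cw` of `R₂ Rp`: the
canonical side of the pair is `b` in both orders — `fst (cw ⟨⟨a, b⟩, ⟨1, wb⟩⟩) = 1` and
`fst (cw ⟨⟨b, a⟩, ⟨0, wb⟩⟩) = 0`. [HNOS 1996, proof of Thm. 1 (the tournament)] [folklore] -/
def beats (cw : List Bool → List Bool) (b wb a : List Bool) : Prop :=
  fstP (cw (boolPair (boolPair a b) (boolPair [true] wb))) = [true] ∧
    fstP (cw (boolPair (boolPair b a) (boolPair [false] wb))) = [false]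

section Tournament

variable {Rp : Language Bool} {cw : List Bool → List Bool}

/-- The canonical witness of a pair does not depend on the witness it is computed from. [folklore] -/
theorem cw_eq_of_mem (hcw : IsCanonWitFn (R₂ Rp) cw) {a b c c' : List Bool}
    (hc : boolPair (boolPair a b) c ∈ R₂ Rp) (hc' : boolPair (boolPair a b) c' ∈ R₂ Rp) :
    cw (boolPair (boolPair a b) c) = cw (boolPair (boolPair a b) c') :=
  hcw.2 _ _ _ hc hc'

/-- The canonical side of a pair whose first side has no witness is the second side. [folklore] -/
theorem fst_cw_eq_true (hcw : IsCanonWitFn (R₂ Rp) cw) {a b c : List Bool} (ha : ¬ HasWit Rp a)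
    (hc : boolPair (boolPair a b) c ∈ R₂ Rp) : fstP (cw (boolPair (boolPair a b) c)) = [true] := by
  rcases (mem_R₂_iff Rp a b _).1 (hcw.1 _ _ hc) with ⟨h, -⟩ | ⟨-, h⟩
  · exact (ha ⟨_, h⟩).elim
  · exact h

/-- The canonical side of a pair whose second side has no witness is the first side. [folklore] -/
theorem fst_cw_eq_false (hcw : IsCanonWitFn (R₂ Rp) cw) {a b c : List Bool} (hb : ¬ HasWit Rp b)
    (hc : boolPair (boolPair a b) c ∈ R₂ Rp) : fstP (cw (boolPair (boolPair a b) c)) = [false] := by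
  rcases (mem_R₂_iff Rp a b _).1 (hcw.1 _ _ hc) with ⟨-, h⟩ | ⟨h, -⟩
  · exact h
  · exact (hb ⟨_, h⟩).elim

/-- **Non-members are beaten by every member** (the selector is forced).
[HNOS 1996, proof of Thm. 1] [folklore] -/
theorem beats_of_not_hasWit (hcw : IsCanonWitFn (R₂ Rp) cw) {a b wb : List Bool} (ha : ¬ HasWit Rp a)
    (hb : boolPair b wb ∈ Rp) : beats cw b wb a :=
  ⟨fst_cw_eq_true hcw ha ((mem_R₂_iff' Rp a b _ _).2 (Or.inr ⟨hb, rfl⟩)),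
    fst_cw_eq_false hcw ha ((mem_R₂_iff' Rp b a _ _).2 (Or.inl ⟨hb, rfl⟩))⟩

/-- **The beating relation is antisymmetric on members** (a tournament without 2-cycles).
[HNOS 1996, proof of Thm. 1] [folklore] -/
theorem not_beats_symm (hcw : IsCanonWitFn (R₂ Rp) cw) {a wa b wb : List Bool}
    (ha : boolPair a wa ∈ Rp) (hb : boolPair b wb ∈ Rp) (h₁ : beats cw b wb a) (h₂ : beats cw a wa b) :
    False := by
  have e := cw_eq_of_mem hcw ((mem_R₂_iff' Rp a b _ _).2 (Or.inr ⟨hb, rfl⟩))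
    ((mem_R₂_iff' Rp a b _ _).2 (Or.inl ⟨ha, rfl⟩))
  have h := h₁.1
  rw [e, h₂.2] at h
  exact absurd h (by decide)

/-- `beats` does not depend on the witness of the beating member. [folklore] -/
theorem beats_congr (hcw : IsCanonWitFn (R₂ Rp) cw) {a b wb wb' : List Bool}
    (hb : boolPair b wb ∈ Rp) (hb' : boolPair b wb' ∈ Rp) : beats cw b wb a ↔ beats cw b wb' a := by
  unfold beats
  rw [cw_eq_of_mem hcw ((mem_R₂_iff' Rp a b _ _).2 (Or.inr ⟨hb, rfl⟩))
      ((mem_R₂_iff' Rp a b _ _).2 (Or.inr ⟨hb', rfl⟩)),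
    cw_eq_of_mem hcw ((mem_R₂_iff' Rp b a _ _).2 (Or.inl ⟨hb, rfl⟩))
      ((mem_R₂_iff' Rp b a _ _).2 (Or.inl ⟨hb', rfl⟩))]

end Tournament

/-! ### `beats` is decidable in polynomial time -/

/-- `⟨e, a⟩ ↦ ⟨⟨a, fst e⟩, ⟨[1], snd e⟩⟩`. [folklore] -/
noncomputable def instT : List Bool → List Bool :=
  pairFn (pairFn sndP (fstP ∘ fstP)) (pairFn (fun _ => [true]) (sndP ∘ fstP))

/-- `⟨e, a⟩ ↦ ⟨⟨fst e, a⟩, ⟨[0], snd e⟩⟩`. [folklore] -/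
noncomputable def instF : List Bool → List Bool :=
  pairFn (pairFn (fstP ∘ fstP) sndP) (pairFn (fun _ => [false]) (sndP ∘ fstP))

/-- `instT ∈ FP`. [folklore] -/
theorem instT_mem_FP : instT ∈ FP :=
  pairFn_mem_FP (pairFn_mem_FP sndP_mem_FP (comp_mem_FP fstP_mem_FP fstP_mem_FP))
    (pairFn_mem_FP (const_mem_FP [true]) (comp_mem_FP sndP_mem_FP fstP_mem_FP))

/-- `instF ∈ FP`. [folklore] -/
theorem instF_mem_FP : instF ∈ FP :=
  pairFn_mem_FP (pairFn_mem_FP (comp_mem_FP fstP_mem_FP fstP_mem_FP) sndP_mem_FP)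
    (pairFn_mem_FP (const_mem_FP [false]) (comp_mem_FP sndP_mem_FP fstP_mem_FP))

/-- Value of `instT` on `⟨e, a⟩`. [folklore] -/
@[simp] theorem instT_boolPair (e a : List Bool) :
    instT (boolPair e a) = boolPair (boolPair a (fstP e)) (boolPair [true] (sndP e)) := by
  simp [instT]

/-- Value of `instF` on `⟨e, a⟩`. [folklore] -/
@[simp] theorem instF_boolPair (e a : List Bool) :
    instF (boolPair e a) = boolPair (boolPair (fstP e) a) (boolPair [false] (sndP e)) := by
  simp [instF]

/-- **The beating language** `BeatsL cw = {⟨e, a⟩ | beats cw (fst e) (snd e) a}`. [folklore] -/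
def BeatsL (cw : List Bool → List Bool) : Language Bool :=
  {z | (fstP ∘ cw ∘ instT) z = (fun _ => [true]) z} ⊓ {z | (fstP ∘ cw ∘ instF) z = (fun _ => [false]) z}

/-- Reading `BeatsL`. [folklore] -/
@[simp] theorem boolPair_mem_BeatsL (cw : List Bool → List Bool) (e a : List Bool) :
    boolPair e a ∈ BeatsL cw ↔ beats cw (fstP e) (sndP e) a := by
  change (fstP (cw (instT (boolPair e a))) = [true] ∧ fstP (cw (instF (boolPair e a))) = [false]) ↔ _
  rw [instT_boolPair, instF_boolPair]
  rfl

/-- **`BeatsL cw ∈ P`** for `cw ∈ FP`. [folklore] -/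
theorem BeatsL_mem_P {cw : List Bool → List Bool} (hcw : cw ∈ FP) : BeatsL cw ∈ Classes.P :=
  inter_mem_P
    (setOf_apply_eq_apply_mem_P (comp_mem_FP fstP_mem_FP (comp_mem_FP hcw instT_mem_FP))
      (const_mem_FP [true]))
    (setOf_apply_eq_apply_mem_P (comp_mem_FP fstP_mem_FP (comp_mem_FP hcw instF_mem_FP))
      (const_mem_FP [false]))

/-! ### Advice lists, certificates and the bad set (HNOS advice) -/

section Advice

variable (Rp : Language Bool) (cw : List Bool → List Bool)

/-- An entry string `e = ⟨k, wk⟩` of an advice list is *valid* if `wk` witnesses `k`. [folklore] -/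
def ValidE (e : List Bool) : Prop :=
  boolPair (fstP e) (sndP e) ∈ Rp

/-- **The certificate predicate**: every valid entry of the advice `K` has key `≠ a` and beats `a`
(what the `NP` side checks to certify `a ∉ N`, given the witnesses stored in `K`).
[HNOS 1996, proof of Thm. 1] [folklore] -/
def Cert (K : List (List Bool)) (a : List Bool) : Prop :=
  ∀ e ∈ K, ValidE Rp e → fstP e ≠ a ∧ beats cw (fstP e) (sndP e) a

/-- **The bad set** of an advice: members that nevertheless pass the certificate.
[HNOS 1996, proof of Thm. 1] [folklore] -/
def Bad (K : List (List Bool)) (a : List Bool) : Prop :=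
  HasWit Rp a ∧ Cert Rp cw K a

variable {Rp cw}

/-- Non-members always pass the certificate. [HNOS 1996, proof of Thm. 1] [folklore] -/
theorem cert_of_not_hasWit (hcw : IsCanonWitFn (R₂ Rp) cw) (K : List (List Bool)) {a : List Bool}
    (ha : ¬ HasWit Rp a) : Cert Rp cw K a := by
  intro e _ he
  refine ⟨fun h => ha ⟨sndP e, ?_⟩, beats_of_not_hasWit hcw ha he⟩
  rw [← h]
  exact he

/-- **The advice lemma**: if no element of `U` is bad for `K` then, on `U`, non-membership is
exactly the certificate. [HNOS 1996, proof of Thm. 1] [folklore] -/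
theorem not_hasWit_iff_cert (hcw : IsCanonWitFn (R₂ Rp) cw) {K : List (List Bool)} {U : Set (List Bool)}
    (hgood : ∀ a ∈ U, ¬ Bad Rp cw K a) {a : List Bool} (ha : a ∈ U) :
    ¬ HasWit Rp a ↔ Cert Rp cw K a :=
  ⟨cert_of_not_hasWit hcw K, fun hc hw => hgood a ha ⟨hw, hc⟩⟩

/-- More advice, fewer bad elements. [folklore] -/
theorem bad_mono {K K' : List (List Bool)} (hKK' : ∀ e ∈ K, e ∈ K') {a : List Bool}
    (h : Bad Rp cw K' a) : Bad Rp cw K a :=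
  ⟨h.1, fun e he hv => h.2 e (hKK' e he) hv⟩

/-- A bad element of an advice containing the valid entry `e` is beaten by `e` (and is bad for any
sub-advice): after adding `e`, the bad set lies in the out-neighbourhood of `e`. [folklore] -/
theorem beats_of_bad {K' : List (List Bool)} {e a : List Bool} (he : e ∈ K') (hv : ValidE Rp e)
    (h : Bad Rp cw K' a) : fstP e ≠ a ∧ beats cw (fstP e) (sndP e) a :=
  h.2 e he hv

/-- The form used by the halving analysis: `Bad (K ++ K₁) a → Bad K a ∧ ∀ valid e ∈ K₁, e beats a`.
[folklore] -/
theorem bad_append_iff (K K₁ : List (List Bool)) (a : List Bool) :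
    Bad Rp cw (K ++ K₁) a ↔ Bad Rp cw K a ∧ ∀ e ∈ K₁, ValidE Rp e → fstP e ≠ a ∧ beats cw (fstP e) (sndP e) a := by
  constructor
  · intro h
    exact ⟨bad_mono (fun e he => List.mem_append_left _ he) h,
      fun e he hv => h.2 e (List.mem_append_right _ he) hv⟩
  · rintro ⟨h, h₁⟩
    refine ⟨h.1, fun e he hv => ?_⟩
    rcases List.mem_append.1 he with he | he
    · exact h.2 e he hv
    · exact h₁ e he hv

/-- **Two bad elements do not beat each other** (with the witnesses of any valid entries keyed by
them): the out-neighbourhoods in the bad set form an oriented graph. [HNOS 1996, proof of Thm. 1] [folklore] -/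
theorem not_beats_of_bad (hcw : IsCanonWitFn (R₂ Rp) cw) {a wa b wb : List Bool}
    (ha : boolPair a wa ∈ Rp) (hb : boolPair b wb ∈ Rp) (h : beats cw b wb a) : ¬ beats cw a wa b :=
  fun h' => not_beats_symm hcw ha hb h h'

/-- The empty advice: every member is bad. [folklore] -/
theorem bad_nil_iff (a : List Bool) : Bad Rp cw [] a ↔ HasWit Rp a := by
  simp [Bad, Cert]

end Advice

end CFKer

end Literature.Computability.Complexity
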